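import Summits.QuantumFields.BalabanUV.T4Continuum.Support.VariationalVectorAvgGDecomposition
import Summits.QuantumFields.BalabanUV.T4Continuum.Support.VariationalHarmonicApproxDown

/-!
# T⁴ programme, spine node NE2 (U1a), lane P2 — «V-AVG-G», file 5: (G″) FOR BAŁABAN's PROJECTED GAUGE FUNCTIONAL ⇐ DIV-AVG ALONE (+ the scalar road's classes)
# — the HARM↓ leg DISCHARGED by file 4, Jensen by file 3, the fine functional with coefficient ONE (two-step coordinates, NESTED scalar kernels; model level;
# cell `pub-balaban`)

NE2 formalisation swarm `b2b-balaban-t4-ne2-formalise-*`, leaf prover 10 GEN 4 (`prover-b2b-balaban-t4-ne2-formalise-leaf-10-g4-0`, V-END holder lineage); journal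
INTENT «V-AVG-G: THE LOWER BRACKET WITHOUT A SLICE MOVE» CLAIMS.log 2026-08-20 18:22Z l.19093, file 5.  Composition BY NAME of file 3 (`avgG_of_legs`, `sum_norm_sq_Qcv_le`),
file 4 (`harmApproxDown_colour`), leaf-01-g8's `VariationalVectorGaugeSliceDist` (p229806: `projG_eq_norm_sub_sq`, `starProjection_orthogonal_mem`, `toLp_mem_orthogonal_iff_isMin`)
and `VariationalHarmonicApprox.toLp_mem_orthogonal_iff_isMin_linear` (p230215), the road's `exists_isMinOn_fib`; nothing defined.

THE STATEMENT (**`avgG_projG_of_divAvg`**).  Two-step coordinates: coarse torus `fine n M` (bonds `R`, scalar site transports `T`, NESTED scalar kernel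
`K = ker Q_T`), fine torus `fine L (fine n M)` (bonds `R′`, one-step site transports `T′` unitary, composite kernel `K′ = ker (Q_T ∘ Q_{T′})`); a fine 1-form `g`
and a coarse 1-form `W` (think `W = Q₁ g`, the one-step line average — the statement is about the pair `(W, g)`, `Q₁` never enters).  ASSUME the scalar road's
displayed classes UB⁺ ∕ P⁺ (both levels) ∕ REG⁺ (the shapes of `harmApprox_colour` ∕ `harmApproxDown_colour`), the one-block mismatch data `m, m₁` of FED⁺ ∕ ONE⁺, and
ONE displayed analytic leg
  (DIV-AVG)  `√((n^d)⁻¹n²)·‖toLp(div_R W) − toLp(L•Q_{T′}(div_{R′} g))‖ ≤ ε_D·√ρ_D`.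
THEN the (G″) socket of files 1–2 holds for Bałaban's projected functional with the NESTED kernels:
  `(n^d)⁻¹(n²·projG R K W) ≤ (√(((nL)^d)⁻¹((nL)²·projG R′ K′ g)) + (ε_D + √(C_P·e_H↓))·√(ρ_D + ((nL)^d)⁻¹((nL)²·divSq_{R′} g)))²`,
  `e_H↓ = ePV Λ C_P C_R ε₁ δ′ + eV Λ C_P δ`, `ε₁ = (d∕4 + 1∕2)·L∕n²`, `δ′ = √(2d(1+d²))·(nLm₁)`, `δ = √d·(nm)`.
So `ε″ = ε_D + √(C_P·e_H↓)` and `ρ′ = ρ_D + DIVSQ♯` — the second regularity functional is the (GF3) quantity one level up, whose V-REG is the (GF3) class (kernel with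
background for the regular gauge ∕ covariant frames: leaf-03-g6 p230361…, leaf-04-g6 p231292 ∕ p231645).  PROOF: `h′ := Π_{S′ᗮ}(div′ g)` is a composite-fibre scalar
minimiser (p230215 §2a) with `‖div′g − h′‖² = projG′ g` (p229806 §1); the coarse scalar minimiser `s` of the same unit datum `ψ′ = Q_T(Q_{T′} h′)` exists (P⁺ coercivity
+ UB⁺); file 4 gives `qWv (Q_{T′} h′ − s) ≤ C_P·e_H↓·nsqv ψ′`; Jensen twice (file 3 §1) and the contraction `‖h′‖ ≤ ‖div′ g‖` give `n^d·L^d·nsqv ψ′ ≤ divSq′ g`; so the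
HARM↓ leg of file 3 with `u := L•s ∈ Sᗮ` is `≤ √(C_P·e_H↓)·√(DIVSQ♯ g)`, and `avgG_of_legs` concludes.
WHAT THIS LEAVES for the lower bracket of the vector END with background: **DIV-AVG** (the commutator of the covariant divergence with the one-step LINE average
against `L`× the one-step scalar BLOCK mean — a first-order lattice consistency statement on regular fields; flat instance next) + the scalar classes + hFEDcurl
(landed).  The choice of NESTED scalar kernels is forced by HARM↓∕HARM↑ (both read `S′ᗮ` through the COMPOSITE average); a host at straight-taxi kernels (part 6,
p229644) differs by holonomy phases — `K` is DATA in the END, so this is an instantiation choice, flagged in CLAIMS.log l.19514.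

HONEST FRAMING (T4-DAG p. 1).  Composition at MODEL level (`E` a finite-dimensional Hilbert space; bonds ∕ site transports DATA, c5 — no identification with Bałaban's
`R_k(U)`); [folklore]; nothing printed is a hypothesis; no `def`, no `def … : Prop`, no `sorry`; axioms standard.  DIV-AVG with background is DISPLAYED, not proved; (G″)
with background therefore NOT proved here; V-END with background ∕ NE2 NOT proved; NE3 OPEN; spine PROVED 0∕9 unchanged; rung (B)+1 on a fixed finite T⁴ — NOT
infinite volume, NOT mass gap, NOT Clay.  HONEST DEPENDENCY (cell, verbatim): continuum YM on T⁴ ⇐ BetaPertH ∧ nine spine estimates (0/9 proved); BetaPertH ⇐ (D1) ∧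
(D4) ∧ CAP+tail; G-an2-4 gates asym, D1 and NE2/3/4.
-/

noncomputable section

namespace Summit.QuantumFields.BalabanUV.T4Continuum.VariationalVectorAvgGProjG

open Finset WithLp
open scoped InnerProductSpace
open Literature.MathematicalPhysics.QuantumFieldTheory.Balaban1983to89.B5Prop11Plancherel (Tor fine unitVec)
open Literature.MathematicalPhysics.QuantumFieldTheory.Balaban1983to89.B5Block118 (bpt)
open Summit.QuantumFields.BalabanUV.T4Continuum.VariationalCovariantAssembly (exists_isMinOn_fib)
open Summit.QuantumFields.BalabanUV.T4Continuum.VariationalColourFederbush (dirUv dirUv_nonneg Qcv misv)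
open Summit.QuantumFields.BalabanUV.T4Continuum.VariationalColourUpperBound (nsqv nsqv_nonneg)
open Summit.QuantumFields.BalabanUV.T4Continuum.VariationalColourOneStepPhys (rhov)
open Summit.QuantumFields.BalabanUV.T4Continuum.VariationalColourScalarPair
  (Scv Sfv qWv qVv Qkv Q1v Scv_nonneg qWv_nonneg norm_sq_le_qWv continuous_Qcv continuous_sum_dirUv)
open Summit.QuantumFields.BalabanUV.T4Continuum.VariationalVectorWeitzenbock (divV divSq divSq_nonneg)
open Summit.QuantumFields.BalabanUV.T4Continuum.VariationalVectorGaugeSlice (sliceSub projG projG_nonneg avgOp avgOp_apply norm_toLp_sq)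
open Summit.QuantumFields.BalabanUV.T4Continuum.VariationalVectorGaugeSliceDist (projG_eq_norm_sub_sq starProjection_orthogonal_mem toLp_mem_orthogonal_iff_isMin)
open Summit.QuantumFields.BalabanUV.T4Continuum.VariationalHarmonicApprox (toLp_mem_orthogonal_iff_isMin_linear)
open Summit.QuantumFields.BalabanUV.T4Continuum.VariationalVectorEndOfLeaves (eV ePV eV_nonneg ePV_nonneg)
open Summit.QuantumFields.BalabanUV.T4Continuum.VariationalVectorAvgGDecomposition (sum_norm_sq_Qcv_le avgG_of_legs)
open Summit.QuantumFields.BalabanUV.T4Continuum.VariationalHarmonicApproxDown (harmApproxDown_colour)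

variable {d : ℕ} {E : Type*} [NormedAddCommGroup E] [InnerProductSpace ℂ E] [CompleteSpace E] [FiniteDimensional ℂ E]
variable (n L : ℕ) [NeZero n] [NeZero L] (M : Fin d → ℕ) [hM : ∀ μ, NeZero (M μ)]

/-! ## §1 Bookkeeping: the `ℓ²` norm of a 0-form is its `nsqv`; Jensen for the composite scalar average -/

omit [InnerProductSpace ℂ E] [CompleteSpace E] [FiniteDimensional ℂ E] [NeZero n] [NeZero L] hM in
/-- `‖toLp f‖² = nsqv f`. [folklore] -/
theorem norm_toLp_sq_eq_nsqv {ι : Fin d → ℕ} [∀ μ, NeZero (ι μ)] (f : Tor ι → E) : ‖toLp 2 f‖ ^ 2 = nsqv f := by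
  rw [norm_toLp_sq]; rfl

omit [CompleteSpace E] [FiniteDimensional ℂ E] in
/-- **JENSEN FOR THE COMPOSITE SCALAR AVERAGE**: `nsqv (Q_T (Q_{T′} h)) ≤ (n^d)⁻¹·(L^d)⁻¹·nsqv h` for contractive site transports (file 3 §1 twice). [folklore] -/
theorem nsqv_Qkv_Q1v_le {T : Tor (fine n M) → (E →L[ℂ] E)} {T' : Tor (fine L (fine n M)) → (E →L[ℂ] E)} (hT : ∀ x, ‖T x‖ ≤ 1)
    (hT' : ∀ x, ‖T' x‖ ≤ 1) (h : Tor (fine L (fine n M)) → E) :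
    nsqv (Qkv n M T (Q1v n L M T' h)) ≤ ((n : ℝ) ^ d)⁻¹ * (((L : ℝ) ^ d)⁻¹ * nsqv h) := by
  have h1 : nsqv (Qkv n M T (Q1v n L M T' h)) ≤ ((n : ℝ) ^ d)⁻¹ * nsqv (Q1v n L M T' h) := by
    unfold nsqv Qkv; exact sum_norm_sq_Qcv_le n M hT _
  have h2 : nsqv (Q1v n L M T' h) ≤ ((L : ℝ) ^ d)⁻¹ * nsqv h := by
    unfold nsqv Q1v; exact sum_norm_sq_Qcv_le L (fine n M) hT' _
  exact h1.trans (mul_le_mul_of_nonneg_left h2 (by positivity))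

/-! ## §2 (G″) for `projG` with the NESTED kernels from DIV-AVG alone -/

/-- **(G″) «V-AVG-G» FOR BAŁABAN's PROJECTED GAUGE FUNCTIONAL ⇐ DIV-AVG** (+ the scalar road's UB⁺ ∕ P⁺ ∕ REG⁺ classes and the FED⁺ ∕ ONE⁺ mismatch data; HARM↓,
Jensen, the fine slice representative and the coarse scalar minimiser DISCHARGED).  Nested kernels `K = ker Q_T`, `K′ = ker (Q_T ∘ Q_{T′})`; the vector one-step
average enters only through the pair `(W, g)` with `W` the field whose coarse functional is bounded (think `W = Q₁ g`). [folklore] -/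
theorem avgG_projG_of_divAvg
    {R : Tor (fine n M) → Fin d → (E →L[ℂ] E)} {R' : Tor (fine L (fine n M)) → Fin d → (E →L[ℂ] E)}
    {T : Tor (fine n M) → (E →L[ℂ] E)} {T' : Tor (fine L (fine n M)) → (E →L[ℂ] E)}
    (hT : ∀ x, ‖T x‖ ≤ 1) (hT' : ∀ x, T' x ∈ unitary (E →L[ℂ] E)) (hR : ∀ y μ, R y μ ∈ unitary (E →L[ℂ] E)) (hR' : ∀ x μ, ‖R' x μ‖ ≤ 1)
    -- FED⁺ data: one-block transport mismatch `m`; ONE⁺ data: in-block ∕ crossing frame defects `m₁`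
    {m : ℝ} (hm : 0 ≤ m) (hmis : ∀ y μ j, ‖misv L (fine n M) R R' T' y μ j‖ ≤ m)
    {m₁ : ℝ} (hm₁ : 0 ≤ m₁)
    (hin : ∀ (y : Tor (fine n M)) (j : Fin d → Fin L) (μ : Fin d), (j μ : ℕ) + 1 < L →
      ‖R' (bpt L (fine n M) y j) μ * star (T' (bpt L (fine n M) y j + unitVec (fine L (fine n M)) μ)) - star (T' (bpt L (fine n M) y j))‖ ≤ m₁)
    (hcross : ∀ (y : Tor (fine n M)) (j : Fin d → Fin L) (μ : Fin d), (j μ : ℕ) + 1 = L →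
      ‖R' (bpt L (fine n M) y j) μ * star (T' (bpt L (fine n M) y j + unitVec (fine L (fine n M)) μ))
        - star (T' (bpt L (fine n M) y j)) * R y μ‖ ≤ m₁)
    -- the scalar road's displayed classes: UB⁺ (both levels), P⁺ (both levels), REG⁺
    {Λ CP CR : ℝ} (hΛ : 0 ≤ Λ) (hCP : 0 ≤ CP) (hCR : 0 ≤ CR)
    (hUBc : ∀ ψ : Tor M → E, ∃ f, Qkv n M T f = ψ ∧ Scv n M R f ≤ Λ * nsqv ψ)
    (hUBf : ∀ ψ : Tor M → E, ∃ g', Qkv n M T (Q1v n L M T' g') = ψ ∧ Sfv n L M R' g' ≤ Λ * nsqv ψ)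
    (hPc : ∀ f, qWv n M f ≤ CP * (Scv n M R f + nsqv (Qkv n M T f)))
    (hPf : ∀ g', qVv n L M g' ≤ CP * (Sfv n L M R' g' + nsqv (Qkv n M T (Q1v n L M T' g'))))
    (hREG : ∀ (ψ : Tor M → E) f, Qkv n M T f = ψ → (∀ f₂, Qkv n M T f₂ = ψ → Scv n M R f ≤ Scv n M R f₂) →
      rhov n M R f ≤ CR * (Scv n M R f + nsqv ψ))
    -- the pair `(W, g)` and the DISPLAYED analytic leg DIV-AVG at it
    (W : Tor (fine n M) → Fin d → E) (g : Tor (fine L (fine n M)) → Fin d → E) {εD ρD : ℝ} (hεD : 0 ≤ εD) (hρD : 0 ≤ ρD)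
    (hDIV : Real.sqrt (((n : ℝ) ^ d)⁻¹ * (n : ℝ) ^ 2)
        * ‖toLp 2 (divV (fine n M) R W) - toLp 2 (fun y => (L : ℂ) • Qcv L (fine n M) T' (divV (fine L (fine n M)) R' g) y)‖ ≤ εD * Real.sqrt ρD) :
    let ε₁ : ℝ := ((d : ℝ) / 4 + 1 / 2) * ((L : ℝ) / (n : ℝ) ^ 2)
    let δ' : ℝ := Real.sqrt (2 * d * (1 + (d : ℝ) ^ 2)) * ((n : ℝ) * L * m₁)
    let δ : ℝ := Real.sqrt d * ((n : ℝ) * m)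
    let eH : ℝ := ePV Λ CP CR ε₁ δ' + eV Λ CP δ
    ((n : ℝ) ^ d)⁻¹ * ((n : ℝ) ^ 2 * projG (fine n M) R (LinearMap.ker (avgOp n M T)) W)
      ≤ (Real.sqrt ((((n : ℝ) * L) ^ d)⁻¹ * (((n : ℝ) * L) ^ 2
              * projG (fine L (fine n M)) R' (LinearMap.ker ((avgOp n M T).comp (avgOp L (fine n M) T'))) g))
          + (εD + Real.sqrt (CP * eH)) * Real.sqrt (ρD + (((n : ℝ) * L) ^ d)⁻¹ * (((n : ℝ) * L) ^ 2 * divSq (fine L (fine n M)) R' g))) ^ 2 := by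
  intro ε₁ δ' δ eH
  have hn : (0 : ℝ) < n := by exact_mod_cast Nat.pos_of_ne_zero (NeZero.ne n)
  have hL : (0 : ℝ) < L := by exact_mod_cast Nat.pos_of_ne_zero (NeZero.ne L)
  have hT1 : ∀ x, ‖T' x‖ ≤ 1 := fun x => VariationalColourFederbush.norm_le_one_of_mem_unitary (hT' x)
  have hε₁ : 0 ≤ ε₁ := by positivity
  have hδ' : 0 ≤ δ' := by positivity
  have hδ : 0 ≤ δ := by positivity
  have heH : 0 ≤ eH := add_nonneg (ePV_nonneg hΛ hCP hCR hε₁ hδ') (eV_nonneg hΛ hCP hδ)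
  -- §a the fine slice representative `h′ := Π_{S′ᗮ}(div′ g)`: a composite-fibre scalar minimiser with `‖div′g − h′‖² = projG′ g`
  set Φ : (Tor (fine L (fine n M)) → E) →ₗ[ℂ] (Tor M → E) := (avgOp n M T).comp (avgOp L (fine n M) T') with hΦ
  set D' : Tor (fine L (fine n M)) → E := divV (fine L (fine n M)) R' g with hD'
  set h' : Tor (fine L (fine n M)) → E := ofLp ((sliceSub (fine L (fine n M)) R' (LinearMap.ker Φ))ᗮ.starProjection (toLp 2 D')) with hh'
  have hh'mem : toLp 2 h' ∈ (sliceSub (fine L (fine n M)) R' (LinearMap.ker Φ))ᗮ := by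
    rw [hh', toLp_ofLp]; exact starProjection_orthogonal_mem _ R' _ _
  have hGf : projG (fine L (fine n M)) R' (LinearMap.ker Φ) g = ‖toLp 2 D' - toLp 2 h'‖ ^ 2 := by
    rw [hh', toLp_ofLp]; exact projG_eq_norm_sub_sq _ R' _ g
  have hΦapp : ∀ f, Φ f = Qkv n M T (Q1v n L M T' f) := fun f => rfl
  set ψ' : Tor M → E := Qkv n M T (Q1v n L M T' h') with hψ'
  have hu : Qkv n M T (Q1v n L M T' h') = ψ' := rfl
  -- minimality of `h′` in `Sfv` letters on the composite fibre of `ψ′`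
  have hcL : 0 < ((n : ℝ) * L) ^ 2 / ((n : ℝ) * L) ^ d := by positivity
  have humin : ∀ g₂, Qkv n M T (Q1v n L M T' g₂) = ψ' → Sfv n L M R' h' ≤ Sfv n L M R' g₂ := by
    intro g₂ hg₂
    have hmin := (toLp_mem_orthogonal_iff_isMin_linear R' Φ h').mp hh'mem g₂ (by rw [hΦapp, hΦapp, hg₂])
    unfold Sfv
    exact mul_le_mul_of_nonneg_left hmin hcL.le
  -- §b the coarse scalar minimiser `s` of the same datum (P⁺ coercivity + UB⁺)
  obtain ⟨fU, hfU, -⟩ := hUBc ψ'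
  have hnormW : ∀ f : Tor (fine n M) → E, ‖f‖ ^ 2 ≤ (n : ℝ) ^ d * qWv n M f := norm_sq_le_qWv n M
  obtain ⟨s, hs, hsmin⟩ := exists_isMinOn_fib (Q := Qkv n M T) (S := Scv n M R) (q := qWv n M) (qZ := nsqv) (continuous_Qcv T)
    (by unfold Scv; exact continuous_sum_dirUv R _) (by positivity) hCP hnormW hPc hfU
  -- §c HARM↓ (file 4): `qWv (Q_{T′} h′ − s) ≤ C_P·e_H↓·nsqv ψ′`
  have hHARM := (harmApproxDown_colour n L M hT' hR hR' hm hmis hm₁ hin hcross hΛ hCP hCR hUBc hUBf hPc hPf hREG hs hsmin hu humin).2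
  -- §d `u := L•s ∈ Sᗮ`
  have hsmem : toLp 2 s ∈ (sliceSub (fine n M) R (LinearMap.ker (avgOp n M T)))ᗮ := by
    refine (toLp_mem_orthogonal_iff_isMin n M T R s).mpr fun f hf => ?_
    have hc : 0 < (n : ℝ) ^ 2 / (n : ℝ) ^ d := by positivity
    have h := hsmin f (by rw [← hs]; exact hf)
    unfold Scv at h
    exact le_of_mul_le_mul_left h hc
  have humem : toLp 2 ((L : ℂ) • s) ∈ (sliceSub (fine n M) R (LinearMap.ker (avgOp n M T)))ᗮ := by
    rw [toLp_smul]; exact Submodule.smul_mem _ _ hsmem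
  -- §e the HARM↓ leg in `ℓ²`: `‖toLp(L•Q_{T′}h′) − toLp(L•s)‖² = L²·nsqv (Q_{T′}h′ − s) = L²·n^d·qWv (…)`
  have hleg_sq : ‖toLp 2 (fun y => (L : ℂ) • Qcv L (fine n M) T' h' y) - toLp 2 ((L : ℂ) • s)‖ ^ 2
      = (L : ℝ) ^ 2 * ((n : ℝ) ^ d * qWv n M (Q1v n L M T' h' - s)) := by
    have e1 : (fun y => (L : ℂ) • Qcv L (fine n M) T' h' y) = (L : ℂ) • Q1v n L M T' h' := by funext y; rfl
    rw [e1, ← toLp_sub, ← smul_sub, toLp_smul, norm_smul, mul_pow, Complex.norm_natCast, norm_toLp_sq_eq_nsqv]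
    unfold qWv
    rw [← mul_assoc ((n : ℝ) ^ d), mul_inv_cancel₀ (by positivity), one_mul]
  -- §f Jensen twice + the projection is a contraction: `n^d·L^d·nsqv ψ′ ≤ divSq′ g`
  have hψ'le : nsqv ψ' ≤ ((n : ℝ) ^ d)⁻¹ * (((L : ℝ) ^ d)⁻¹ * divSq (fine L (fine n M)) R' g) := by
    have h1 := nsqv_Qkv_Q1v_le n L M hT hT1 h'
    have h2 : nsqv h' ≤ divSq (fine L (fine n M)) R' g := by
      rw [← norm_toLp_sq_eq_nsqv, hh', toLp_ofLp]
      calc ‖(sliceSub (fine L (fine n M)) R' (LinearMap.ker Φ))ᗮ.starProjection (toLp 2 D')‖ ^ 2 ≤ ‖toLp 2 D'‖ ^ 2 :=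
            pow_le_pow_left₀ (norm_nonneg _) (Submodule.norm_starProjection_apply_le _ _) 2
        _ = divSq (fine L (fine n M)) R' g := by rw [norm_toLp_sq, hD']; rfl
    exact h1.trans (mul_le_mul_of_nonneg_left (mul_le_mul_of_nonneg_left h2 (by positivity)) (by positivity))
  -- §g the HARM↓ leg in END units: `√((n^d)⁻¹n²)·‖…‖ ≤ √(C_P·e_H↓)·√(DIVSQ♯ g)`
  have hHARMleg : Real.sqrt (((n : ℝ) ^ d)⁻¹ * (n : ℝ) ^ 2) * ‖toLp 2 (fun y => (L : ℂ) • Qcv L (fine n M) T' h' y) - toLp 2 ((L : ℂ) • s)‖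
      ≤ Real.sqrt (CP * eH) * Real.sqrt ((((n : ℝ) * L) ^ d)⁻¹ * (((n : ℝ) * L) ^ 2 * divSq (fine L (fine n M)) R' g)) := by
    have hl0 : 0 ≤ Real.sqrt (((n : ℝ) ^ d)⁻¹ * (n : ℝ) ^ 2) * ‖toLp 2 (fun y => (L : ℂ) • Qcv L (fine n M) T' h' y) - toLp 2 ((L : ℂ) • s)‖ := by
      positivity
    rw [← Real.sqrt_sq hl0, ← Real.sqrt_mul (by positivity)]
    refine Real.sqrt_le_sqrt ?_
    rw [mul_pow, Real.sq_sqrt (by positivity), hleg_sq]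
    -- `(n^d)⁻¹n² · L² · n^d · qWv ≤ C_P e_H · ((nL)^d)⁻¹ (nL)² divSq′`
    have hq : qWv n M (Q1v n L M T' h' - s) ≤ CP * (eH * (((n : ℝ) ^ d)⁻¹ * (((L : ℝ) ^ d)⁻¹ * divSq (fine L (fine n M)) R' g))) :=
      hHARM.trans (mul_le_mul_of_nonneg_left (mul_le_mul_of_nonneg_left hψ'le heH) hCP)
    have hnd : (0 : ℝ) < (n : ℝ) ^ d := by positivity
    have hLd : (0 : ℝ) < (L : ℝ) ^ d := by positivity
    calc ((n : ℝ) ^ d)⁻¹ * (n : ℝ) ^ 2 * ((L : ℝ) ^ 2 * ((n : ℝ) ^ d * qWv n M (Q1v n L M T' h' - s)))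
        ≤ ((n : ℝ) ^ d)⁻¹ * (n : ℝ) ^ 2 * ((L : ℝ) ^ 2 * ((n : ℝ) ^ d
            * (CP * (eH * (((n : ℝ) ^ d)⁻¹ * (((L : ℝ) ^ d)⁻¹ * divSq (fine L (fine n M)) R' g)))))) := by gcongr
      _ = CP * eH * ((((n : ℝ) * L) ^ d)⁻¹ * (((n : ℝ) * L) ^ 2 * divSq (fine L (fine n M)) R' g)) := by
          rw [mul_pow, mul_pow, mul_inv]
          field_simp
  -- §h file 3's socket theorem
  have h := avgG_of_legs n L M R (LinearMap.ker (avgOp n M T)) W hT1 D' h' humem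
    (Gf := (((n : ℝ) * L) ^ d)⁻¹ * (((n : ℝ) * L) ^ 2 * projG (fine L (fine n M)) R' (LinearMap.ker Φ) g))
    hεD (Real.sqrt_nonneg (CP * eH)) hρD (mul_nonneg (by positivity) (mul_nonneg (by positivity) (divSq_nonneg _ _ _))) (by rw [hGf]) hDIV hHARMleg
  exact h

end Summit.QuantumFields.BalabanUV.T4Continuum.VariationalVectorAvgGProjG

end
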